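import Summits.Ventures.HodgeRepro2.T5SU11KernelPowerSeries
import Summits.Ventures.HodgeRepro2.T5SU11ResolventDerivativeMu
import Mathlib.Analysis.Analytic.OfScalars

/-!
# The kernel and the resolvent are real-analytic in the spectral parameter

Row 577's power series `K_{λ(μ)}(t, s) = Σ_k (μ − μ₂)^k K_{λ₂}^{∘(k+1)}(t, s)` on the disc `|μ − μ₂| < (λ₂ − 1)²` and
row 559's `G^I_{λ(μ)} g(t) = Σ_k (μ − μ₂)^k (G^I_{λ₂})^{k+1} g(t)` for `g ∈ W_1`, packaged as Mathlib power series
(`FormalMultilinearSeries.ofScalars`) with the radius bound from the sharp `W_1` constants of the iterates (row 557):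

* `kernel_hasFPowerSeriesOnBall` — **`μ ↦ K_{λ(μ)}(t, s)` has the power series `Σ_k K_{λ₂}^{∘(k+1)}(t, s) (μ − μ₂)^k` on the
  ball of radius `(λ₂ − 1)²` about `μ₂ = λ₂(λ₂ − 2)`**;
* `kernel_analyticAt_mu`, `kernel_analyticOnNhd_mu` — **`μ ↦ K_{λ(μ)}(t, s)` is real-analytic on `(−1, ∞)`**;
* `resolvent_hasFPowerSeriesOnBall`, `resolvent_analyticAt_mu`, `resolvent_analyticOnNhd_mu` — the same for
  `μ ↦ G^I_{λ(μ)} g(t)`, `g ∈ W_1`;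
* `kernel_analyticAt_lam`, `resolvent_analyticAt_lam` — **analytic in `λ` on `(1, ∞)`** as well (composition with the
  analytic `λ ↦ λ(λ − 2)`).

Here `λ(μ) = 1 + √(μ + 1)`, `μ = λ(λ − 2)` (row 562). Nothing is claimed about (N).

Blind lane: Mathlib + the HodgeRepro2 prefix only; no sorry; axioms ⊆ {propext, Classical.choice,
Quot.sound}.
-/

namespace Summit.Ventures.HodgeRepro2.T5SU11KernelAnalytic

open Filter Topology MeasureTheory
open Set (Ioi Ioc)
open T5SU11Cartan T5SU11SphericalFunction T5SU11SphericalDecay T5SU11RadialGreenKernel T5SU11RadialGreenImproper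
  T5SU11KernelDifferenceRegularity T5SU11WeightedSpaceGroundState T5SU11ResolventPowerSeriesGroundState
  T5SU11KernelDerivative T5SU11KernelPowerSeries T5SU11ResolventDerivativeMu

/-- The spectral point `μ₂ + y`, `|y| < (λ₂ − 1)²`, `μ₂ = λ₂(λ₂ − 2)`, is `λ(λ − 2)` for `λ = 1 + √(μ₂ + y + 1) > 1`,
and `λ(λ − 2) − μ₂ = y`. -/
theorem lam_of_shift {lam₂ y : ℝ} (hy : |y| < (lam₂ - 1) ^ 2) :
    1 < 1 + Real.sqrt (lam₂ * (lam₂ - 2) + y + 1) ∧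
      (1 + Real.sqrt (lam₂ * (lam₂ - 2) + y + 1)) * (1 + Real.sqrt (lam₂ * (lam₂ - 2) + y + 1) - 2)
        - lam₂ * (lam₂ - 2) = y := by
  have hpos : 0 < lam₂ * (lam₂ - 2) + y + 1 := by
    have := (abs_lt.mp hy).1
    nlinarith
  refine ⟨?_, ?_⟩
  · have := Real.sqrt_pos.mpr hpos
    linarith
  · have hsq := Real.sq_sqrt hpos.le
    linear_combination hsq

/-- `λ(μ)(λ(μ) − 2) = μ` for `μ ≥ −1`, `λ(μ) = 1 + √(μ + 1)`. -/
theorem mu_of_sqrt {μ : ℝ} (hμ : -1 ≤ μ) :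
    (1 + Real.sqrt (μ + 1)) * (1 + Real.sqrt (μ + 1) - 2) = μ := by
  have hsq := Real.sq_sqrt (by linarith : (0 : ℝ) ≤ μ + 1)
  linear_combination hsq

section measure

variable [MeasurableSpace Circle] [BorelSpace Circle]

variable {lam₂ : ℝ} (hlam₂ : 1 < lam₂)

section resolvent

variable {g : ℝ → ℝ} (hg : ContinuousOn g (Ioi 0)) {D : ℝ} (hD : ∀ s, 0 < s → |g s| ≤ D * sph 1 (hyp s))

include hlam₂ hg hD in
/-- **The resolvent of a `W_1` source is a power series in `μ`**: `μ ↦ G^I_{λ(μ)} g(t)` has the power series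
`Σ_k (G^I_{λ₂})^{k+1} g(t) (μ − μ₂)^k` on the ball of radius `(λ₂ − 1)²` about `μ₂ = λ₂(λ₂ − 2)`. -/
theorem resolvent_hasFPowerSeriesOnBall {t : ℝ} (ht : 0 < t) :
    HasFPowerSeriesOnBall
      (fun μ => greenSolI (fun t => sph (1 + Real.sqrt (μ + 1)) (hyp t)) (sphDecay (1 + Real.sqrt (μ + 1))) g t)
      (FormalMultilinearSeries.ofScalars ℝ
        (fun k => ((greenSolI (fun t => sph lam₂ (hyp t)) (sphDecay lam₂))^[k + 1] g) t))
      (lam₂ * (lam₂ - 2)) (ENNReal.ofReal ((lam₂ - 1) ^ 2)) := by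
  have hp : 0 < (lam₂ - 1) ^ 2 := by
    have : 0 < lam₂ - 1 := by linarith
    positivity
  set c : ℕ → ℝ := fun k => ((greenSolI (fun t => sph lam₂ (hyp t)) (sphDecay lam₂))^[k + 1] g) t with hc
  -- the coefficient bound `|c k| ((λ₂ − 1)²)^k ≤ D Ξ(t)/(λ₂ − 1)²` (row 557)
  have hcb : ∀ k, |c k| * ((lam₂ - 1) ^ 2) ^ k ≤ D * sph 1 (hyp t) / (lam₂ - 1) ^ 2 := by
    intro k
    have hb := (iterate_mem_weighted_one hlam₂ hg hD (k + 1)).2 t ht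
    rw [le_div_iff₀ (pow_pos hp _)] at hb
    rw [le_div_iff₀ hp, mul_assoc, ← pow_succ]
    exact hb
  refine HasFPowerSeriesOnBall.mk ?_ (ENNReal.ofReal_pos.mpr hp) ?_
  · have h := (FormalMultilinearSeries.ofScalars ℝ c).le_radius_of_bound (D * sph 1 (hyp t) / (lam₂ - 1) ^ 2)
      (r := Real.toNNReal ((lam₂ - 1) ^ 2)) (fun n => ?_)
    · exact h
    · rw [FormalMultilinearSeries.ofScalars_norm, Real.norm_eq_abs, Real.coe_toNNReal _ hp.le]
      exact hcb n
  · intro y hy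
    rw [Metric.mem_eball, edist_dist, dist_zero_right, Real.norm_eq_abs, ENNReal.ofReal_lt_ofReal_iff hp] at hy
    obtain ⟨hlam, hκ⟩ := lam_of_shift hy
    have h := hasSum_neumann_weighted_one hlam hlam₂ hg hD (by rw [hκ]; exact hy) ht
    rw [hκ] at h
    simp only [FormalMultilinearSeries.ofScalars_apply_eq, smul_eq_mul]
    exact h.congr_fun (fun k => by rw [hc]; ring)

include hlam₂ hg hD in
/-- The resolvent of a `W_1` source is real-analytic in `μ` at `μ₂ = λ₂(λ₂ − 2)`. -/
theorem resolvent_analyticAt_mu' {t : ℝ} (ht : 0 < t) :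
    AnalyticAt ℝ
      (fun μ => greenSolI (fun t => sph (1 + Real.sqrt (μ + 1)) (hyp t)) (sphDecay (1 + Real.sqrt (μ + 1))) g t)
      (lam₂ * (lam₂ - 2)) :=
  (resolvent_hasFPowerSeriesOnBall hlam₂ hg hD ht).analyticAt

omit hlam₂ in
include hg hD in
/-- **The resolvent of a `W_1` source is real-analytic in `μ`** at every `μ₂ > −1`. -/
theorem resolvent_analyticAt_mu {μ₂ : ℝ} (hμ₂ : -1 < μ₂) {t : ℝ} (ht : 0 < t) :
    AnalyticAt ℝ
      (fun μ => greenSolI (fun t => sph (1 + Real.sqrt (μ + 1)) (hyp t)) (sphDecay (1 + Real.sqrt (μ + 1))) g t)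
      μ₂ := by
  have h := resolvent_analyticAt_mu' (one_lt_one_add_sqrt hμ₂) hg hD ht
  rwa [mu_of_sqrt hμ₂.le] at h

omit hlam₂ in
include hg hD in
/-- The resolvent of a `W_1` source is real-analytic in `μ` on `(−1, ∞)`. -/
theorem resolvent_analyticOnNhd_mu {t : ℝ} (ht : 0 < t) :
    AnalyticOnNhd ℝ
      (fun μ => greenSolI (fun t => sph (1 + Real.sqrt (μ + 1)) (hyp t)) (sphDecay (1 + Real.sqrt (μ + 1))) g t)
      (Ioi (-1)) :=
  fun _ hμ => resolvent_analyticAt_mu hg hD hμ ht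

omit hlam₂ in
include hg hD in
/-- **The resolvent of a `W_1` source is real-analytic in `λ`** at every `λ₂ > 1`. -/
theorem resolvent_analyticAt_lam {lam₂ : ℝ} (hlam₂ : 1 < lam₂) {t : ℝ} (ht : 0 < t) :
    AnalyticAt ℝ (fun lam => greenSolI (fun t => sph lam (hyp t)) (sphDecay lam) g t) lam₂ := by
  have hμ : AnalyticAt ℝ (fun lam : ℝ => lam * (lam - 2)) lam₂ :=
    analyticAt_id.mul (analyticAt_id.sub analyticAt_const)
  have h := (resolvent_analyticAt_mu' hlam₂ hg hD ht).comp_of_eq hμ rfl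
  refine h.congr ?_
  filter_upwards [eventually_gt_nhds hlam₂] with lam hlam
  simp only [Function.comp]
  rw [one_add_sqrt_eq hlam]

end resolvent

section kernel

variable {s : ℝ} (hs : 0 < s)

include hlam₂ hs in
/-- **The kernel is a power series in `μ`**: `μ ↦ K_{λ(μ)}(t, s)` has the power series
`Σ_k K_{λ₂}^{∘(k+1)}(t, s) (μ − μ₂)^k` (`K_{λ₂}^{∘(k+1)}(t, s) = (G^I_{λ₂})^k K_{λ₂}(·, s)(t)`) on the ball of radius
`(λ₂ − 1)²` about `μ₂ = λ₂(λ₂ − 2)`. -/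
theorem kernel_hasFPowerSeriesOnBall {t : ℝ} (ht : 0 < t) :
    HasFPowerSeriesOnBall (fun μ => sphGreenKernel (1 + Real.sqrt (μ + 1)) t s)
      (FormalMultilinearSeries.ofScalars ℝ
        (fun k => ((greenSolI (fun t => sph lam₂ (hyp t)) (sphDecay lam₂))^[k] (fun r => sphGreenKernel lam₂ r s)) t))
      (lam₂ * (lam₂ - 2)) (ENNReal.ofReal ((lam₂ - 1) ^ 2)) := by
  obtain ⟨D, _, hD⟩ := kernel_source_mem_weighted_one hlam₂ hs
  have hg := kernel_source_continuousOn hlam₂ hs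
  have hp : 0 < (lam₂ - 1) ^ 2 := by
    have : 0 < lam₂ - 1 := by linarith
    positivity
  set c : ℕ → ℝ :=
    fun k => ((greenSolI (fun t => sph lam₂ (hyp t)) (sphDecay lam₂))^[k] (fun r => sphGreenKernel lam₂ r s)) t with hc
  -- the coefficient bound `|c k| ((λ₂ − 1)²)^k ≤ D_s Ξ(t)` (row 557 on the kernel source)
  have hcb : ∀ k, |c k| * ((lam₂ - 1) ^ 2) ^ k ≤ D * sph 1 (hyp t) := by
    intro k
    have hb := (iterate_mem_weighted_one hlam₂ hg hD k).2 t ht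
    rw [le_div_iff₀ (pow_pos hp _)] at hb
    exact hb
  refine HasFPowerSeriesOnBall.mk ?_ (ENNReal.ofReal_pos.mpr hp) ?_
  · have h := (FormalMultilinearSeries.ofScalars ℝ c).le_radius_of_bound (D * sph 1 (hyp t))
      (r := Real.toNNReal ((lam₂ - 1) ^ 2)) (fun n => ?_)
    · exact h
    · rw [FormalMultilinearSeries.ofScalars_norm, Real.norm_eq_abs, Real.coe_toNNReal _ hp.le]
      exact hcb n
  · intro y hy
    rw [Metric.mem_eball, edist_dist, dist_zero_right, Real.norm_eq_abs, ENNReal.ofReal_lt_ofReal_iff hp] at hy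
    obtain ⟨hlam, hκ⟩ := lam_of_shift hy
    have h := hasSum_kernel_neumann hlam hlam₂ hs (by rw [hκ]; exact hy) ht
    rw [hκ] at h
    simp only [FormalMultilinearSeries.ofScalars_apply_eq, smul_eq_mul]
    exact h.congr_fun (fun k => by rw [hc]; ring)

include hlam₂ hs in
/-- The kernel is real-analytic in `μ` at `μ₂ = λ₂(λ₂ − 2)`. -/
theorem kernel_analyticAt_mu' {t : ℝ} (ht : 0 < t) :
    AnalyticAt ℝ (fun μ => sphGreenKernel (1 + Real.sqrt (μ + 1)) t s) (lam₂ * (lam₂ - 2)) :=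
  (kernel_hasFPowerSeriesOnBall hlam₂ hs ht).analyticAt

omit hlam₂ in
include hs in
/-- **THE KERNEL IS REAL-ANALYTIC IN THE SPECTRAL PARAMETER**: `μ ↦ K_{λ(μ)}(t, s)` is analytic at every `μ₂ > −1`. -/
theorem kernel_analyticAt_mu {μ₂ : ℝ} (hμ₂ : -1 < μ₂) {t : ℝ} (ht : 0 < t) :
    AnalyticAt ℝ (fun μ => sphGreenKernel (1 + Real.sqrt (μ + 1)) t s) μ₂ := by
  have h := kernel_analyticAt_mu' (one_lt_one_add_sqrt hμ₂) hs ht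
  rwa [mu_of_sqrt hμ₂.le] at h

omit hlam₂ in
include hs in
/-- The kernel is real-analytic in `μ` on `(−1, ∞)`. -/
theorem kernel_analyticOnNhd_mu {t : ℝ} (ht : 0 < t) :
    AnalyticOnNhd ℝ (fun μ => sphGreenKernel (1 + Real.sqrt (μ + 1)) t s) (Ioi (-1)) :=
  fun _ hμ => kernel_analyticAt_mu hs hμ ht

omit hlam₂ in
include hs in
/-- **The kernel is real-analytic in `λ`** at every `λ₂ > 1`. -/
theorem kernel_analyticAt_lam {lam₂ : ℝ} (hlam₂ : 1 < lam₂) {t : ℝ} (ht : 0 < t) :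
    AnalyticAt ℝ (fun lam => sphGreenKernel lam t s) lam₂ := by
  have hμ : AnalyticAt ℝ (fun lam : ℝ => lam * (lam - 2)) lam₂ :=
    analyticAt_id.mul (analyticAt_id.sub analyticAt_const)
  have h := (kernel_analyticAt_mu' hlam₂ hs ht).comp_of_eq hμ rfl
  refine h.congr ?_
  filter_upwards [eventually_gt_nhds hlam₂] with lam hlam
  simp only [Function.comp]
  rw [one_add_sqrt_eq hlam]

end kernel

end measure

end Summit.Ventures.HodgeRepro2.T5SU11KernelAnalytic
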